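import Summits.Ventures.WeilGRH.KeyWindowSesq
import Summits.Ventures.WeilGRH.KeyOneVectorTorus
import HarnessLib

/-!
# GRH arm (rh-explicit, venture WeilGRH): the one-vector principle on WINDOW functions and its eigenvalue-free
  SECTION form — «for every admissible datum `z`, `Re x*S(z)x ≤ B·x*x` with the ONE certified vector `x`»

Cell `rh-explicit`, WEIL TRACK — GRH ARM (lit/typing seat weil-grh-5; step (iii) of the bridge plan GRH-LIT-AS-PRINTED
A27, SECTION language).  Sequel of `KeyOneVectorPrinciple.lean` / `KeyOneVectorTorus.lean` (the principle on TEST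
functions, spectral side) and of `KeyMarkovForm.lean` / `KeyWindowSesq.lean` (position side: the Markov key form
`keyMarkovForm a L v b u` is defined on every window function and is AFFINE in the data there too,
`keyMarkovForm_eq_zero_key_sub_of_isWindowFunction`; Gram expansion on finite sections).

* the autocorrelation of a window function on `[-b, b]` vanishes at `|x| ≥ 2b`
  (`weilConv_weilReflect_eq_zero_of_isWindowFunction`), so the spike sums over `log n < 2b` and over `n ≤ N`,
  `e^{2b} ≤ N + 1`, agree (`sum_range_spikes_eq_sum_weilPrimeIndex_of_isWindowFunction`);
* **the one-vector maximum principle for window functions**: if `v⋆` is anti-aligned with the spikes of `u`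
  (`Re(v⋆(n)(u ⋆ ũ)(log n)) = −‖(u ⋆ ũ)(log n)‖` at the visible `n` with `Λ(n) ≠ 0`) then
  `keyMarkovForm a L v b u ≤ keyMarkovForm a L v⋆ b u` for ALL data with `‖v(n)‖ ≤ 1`
  (`keyMarkovForm_le_of_antialigned_of_isWindowFunction`); real `u`: a sign condition (`…_of_real_sign_…`); on the
  character torus below `(log 5)/2` (`v(4) = v(2)²`): `a₂ ≥ 4a₄ ≥ 0`, `a₃ ≥ 0` make the `(5/·)` phases extremal
  (`keyMarkovForm_le_of_real_torus_four_of_isWindowFunction`, via `torus_coupling_le`; `N = 3, 2` versions);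
* **sections**: `conj χ_n = χ_{−n}` and a trigonometric section with `c_{−n} = conj c_n` is real
  (`conj_sum_modes_smul_chi`); its autocorrelation at lag `t ∈ [0, 2b]` is the finite hermitian form
  `Σ_m Σ_n c_m conj(c_n) shiftCoeff b t m n` (`weilConv_weilReflect_sum_smul_chi`) — so the spikes `α_n(x)` of a
  certified vector are closed-form expressions in its coefficients;
* **THE SECTION PRINCIPLE, eigenvalue-free** (`section_re_sum_le_of_antialigned`, `…_chi`, `…_real_torus_four_chi`):
  for a finite window family `f_i` (Yoshida's `χ_n`, the sector bases) and ONE coefficient vector `x` with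
  `u = Σ x_i f_i` anti-aligned to `v⋆` and a certified Rayleigh bound `keyMarkovForm a L v⋆ b u ≤ B‖u‖₂²`:
  `Re Σ_i Σ_j x_i conj(x_j) S_v(f_i, f_j) ≤ B‖u‖₂²` for EVERY admissible `v` — i.e. the bottom of the hermitian
  section matrix `S(v)` is `≤ B` at every datum, witnessed by the same vector (weil-grh-4's single-state
  certificates G33/G34, GRH/STRUCTURE §16(f)–§17: «sup_z λ_min S_N(z) = λ_min S_N(z⋆)», the `≤` half).

Everything is proved; no definitions; no named facts; RH/GRH-free; instance data are not here.  Sources: Weil 1952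
(11) pp. 261–262 [Weil1952FormulesExplicites]; Bombieri 2000 Thm 2 p. 193 [Bombieri2000Weil]; Yoshida 1992 §5 [Yoshida1992].
-/

set_option autoImplicit false

noncomputable section

open Complex Filter Set MeasureTheory
open scoped Real Topology ComplexConjugate ArithmeticFunction.vonMangoldt

namespace Summit.Ventures.WeilGRH

open Literature.NumberTheory.LFunctions
open Literature.NumberTheory.LFunctions.Yoshida1992 (modes chi chiCore mem_modes)
open Summit.RiemannHypothesis.RiemannHypothesis.Theorems.WeilFormatC

variable {b : ℝ} {u : ℝ → ℂ}

/-! ## The autocorrelation of a window function lives on `(-2b, 2b)` -/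

/-- For a window function `u` on `[-b, b]` and `|x| ≥ 2b`: `(u ⋆ ũ)(x) = 0` (the integrand
`u(y + x) conj u(y)` vanishes off the null set `{−b, b}`). [cite: Yoshida1992, §2 (support of g ⋆ g̃)] -/
theorem weilConv_weilReflect_eq_zero_of_isWindowFunction (hu : IsWindowFunction b u) {x : ℝ}
    (hx : 2 * b ≤ |x|) : weilConv u (weilReflect u) x = 0 := by
  rw [weilConv_weilReflect_eq_integral_shift_pair]
  apply integral_eq_zero_of_ae
  have hnull : volume ({-b, b} : Set ℝ) = 0 := (Set.toFinite _).measure_zero _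
  filter_upwards [measure_eq_zero_iff_ae_notMem.1 hnull] with y hy
  rw [Pi.zero_apply]
  by_cases h1 : y ∈ Icc (-b) b
  · by_cases h2 : y + x ∈ Icc (-b) b
    · exfalso
      apply hy
      rw [mem_Icc] at h1 h2
      rcases le_or_gt 0 x with hx0 | hx0
      · rw [abs_of_nonneg hx0] at hx
        have : y = -b := le_antisymm (by linarith [h2.2]) h1.1
        exact Or.inl this
      · rw [abs_of_neg hx0] at hx
        have : y = b := le_antisymm h1.2 (by linarith [h2.1])
        exact Or.inr this
    · rw [hu.eq_zero _ h2, zero_mul]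
  · rw [hu.eq_zero _ h1, map_zero, mul_zero]

/-- For a window function on `[-b, b]` and `e^{2b} ≤ N + 1` the spike sums over `n ≤ N` and over `log n < 2b`
agree. [folklore] -/
theorem sum_range_spikes_eq_sum_weilPrimeIndex_of_isWindowFunction (hu : IsWindowFunction b u) {N : ℕ}
    (hN : Real.exp (2 * b) ≤ (N : ℝ) + 1) (c : ℕ → ℂ) :
    ∑ n ∈ Finset.range (N + 1), (Λ n : ℝ) / Real.sqrt n *
        (2 * (c n * weilConv u (weilReflect u) (Real.log n)).re) =
      ∑ n ∈ weilPrimeIndex b, (Λ n : ℝ) / Real.sqrt n *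
        (2 * (c n * weilConv u (weilReflect u) (Real.log n)).re) := by
  symm
  refine Finset.sum_subset (weilPrimeIndex_subset_range hN) fun n _ hnot ↦ ?_
  have hge : 2 * b ≤ Real.log n := by
    by_contra h
    push Not at h
    exact hnot (mem_weilPrimeIndex.2 h)
  rw [weilConv_weilReflect_eq_zero_of_isWindowFunction hu (hge.trans (le_abs_self _)), mul_zero,
    Complex.zero_re, mul_zero, mul_zero]

/-! ## Spike bounds and the one-vector principle on window functions -/

/-- `Re(v k) ≥ −‖k‖` for `‖v‖ ≤ 1`. [folklore] -/
theorem neg_norm_le_re_mul_of_norm_le_one {v : ℂ} (hv : ‖v‖ ≤ 1) (k : ℂ) : -‖k‖ ≤ (v * k).re := by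
  have h := (abs_le.1 (Complex.abs_re_le_norm (v * k))).1
  rw [norm_mul] at h
  have h1 := mul_le_of_le_one_left (norm_nonneg k) hv
  linarith

/-- `Re(v k) ≤ ‖k‖` for `‖v‖ ≤ 1`. [folklore] -/
theorem re_mul_le_norm_of_norm_le_one {v : ℂ} (hv : ‖v‖ ≤ 1) (k : ℂ) : (v * k).re ≤ ‖k‖ := by
  have h := (abs_le.1 (Complex.abs_re_le_norm (v * k))).2
  rw [norm_mul] at h
  linarith [mul_le_of_le_one_left (norm_nonneg k) hv]

/-- **Upper spike bound on window functions**: for `‖v(n)‖ ≤ 1`,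
`keyMarkovForm a L v b u ≤ keyMarkovForm a L 0 b u + Σ_{log n<2b} (Λ(n)/√n)·2‖(u ⋆ ũ)(log n)‖`. [folklore] -/
theorem keyMarkovForm_le_zero_key_add_of_isWindowFunction (hu : IsWindowFunction b u) (a : ℕ) (L : ℝ)
    {v : ℕ → ℂ} (hv : ∀ n, ‖v n‖ ≤ 1) :
    keyMarkovForm a L v b u ≤ keyMarkovForm a L 0 b u +
      ∑ n ∈ weilPrimeIndex b, (Λ n : ℝ) / Real.sqrt n * (2 * ‖weilConv u (weilReflect u) (Real.log n)‖) := by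
  rw [keyMarkovForm_eq_zero_key_sub_of_isWindowFunction hu a L v b]
  have hS : -(∑ n ∈ weilPrimeIndex b, (Λ n : ℝ) / Real.sqrt n * (2 * ‖weilConv u (weilReflect u) (Real.log n)‖)) ≤
      ∑ n ∈ weilPrimeIndex b, (Λ n : ℝ) / Real.sqrt n *
        (2 * (v n * weilConv u (weilReflect u) (Real.log n)).re) := by
    rw [← Finset.sum_neg_distrib]
    refine Finset.sum_le_sum fun n _ ↦ ?_
    rw [← mul_neg]
    refine mul_le_mul_of_nonneg_left ?_ (div_nonneg ArithmeticFunction.vonMangoldt_nonneg (Real.sqrt_nonneg _))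
    linarith [neg_norm_le_re_mul_of_norm_le_one (hv n) (weilConv u (weilReflect u) (Real.log n))]
  linarith

/-- **Lower spike bound on window functions**: for `‖v(n)‖ ≤ 1`,
`keyMarkovForm a L 0 b u − Σ_{log n<2b} (Λ(n)/√n)·2‖(u ⋆ ũ)(log n)‖ ≤ keyMarkovForm a L v b u`. [folklore] -/
theorem keyMarkovForm_ge_zero_key_sub_of_isWindowFunction (hu : IsWindowFunction b u) (a : ℕ) (L : ℝ)
    {v : ℕ → ℂ} (hv : ∀ n, ‖v n‖ ≤ 1) :
    keyMarkovForm a L 0 b u -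
        ∑ n ∈ weilPrimeIndex b, (Λ n : ℝ) / Real.sqrt n * (2 * ‖weilConv u (weilReflect u) (Real.log n)‖) ≤
      keyMarkovForm a L v b u := by
  rw [keyMarkovForm_eq_zero_key_sub_of_isWindowFunction hu a L v b]
  refine sub_le_sub_left (Finset.sum_le_sum fun n _ ↦ ?_) _
  refine mul_le_mul_of_nonneg_left ?_ (div_nonneg ArithmeticFunction.vonMangoldt_nonneg (Real.sqrt_nonneg _))
  linarith [re_mul_le_norm_of_norm_le_one (hv n) (weilConv u (weilReflect u) (Real.log n))]

/-- **THE ONE-VECTOR MAXIMUM PRINCIPLE ON WINDOW FUNCTIONS.**  If `v⋆` is anti-aligned with the spikes of the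
window function `u` — `Re(v⋆(n)·(u ⋆ ũ)(log n)) = −‖(u ⋆ ũ)(log n)‖` at every `n` with `log n < 2b`, `Λ(n) ≠ 0` —
then `keyMarkovForm a L v b u ≤ keyMarkovForm a L v⋆ b u` for ALL data of norm `≤ 1`.
[cite: Weil1952FormulesExplicites, (11) pp. 261–262 (prime term linear in χ)] -/
theorem keyMarkovForm_le_of_antialigned_of_isWindowFunction (hu : IsWindowFunction b u) (a : ℕ) (L : ℝ)
    {v vstar : ℕ → ℂ} (hv : ∀ n, ‖v n‖ ≤ 1)
    (hstar : ∀ n ∈ weilPrimeIndex b, Λ n ≠ 0 →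
      (vstar n * weilConv u (weilReflect u) (Real.log n)).re = -‖weilConv u (weilReflect u) (Real.log n)‖) :
    keyMarkovForm a L v b u ≤ keyMarkovForm a L vstar b u := by
  rw [keyMarkovForm_eq_zero_key_sub_of_isWindowFunction hu a L v b,
    keyMarkovForm_eq_zero_key_sub_of_isWindowFunction hu a L vstar b]
  refine sub_le_sub_left (Finset.sum_le_sum fun n hn ↦ ?_) _
  by_cases hΛ : Λ n = 0
  · rw [hΛ, zero_div, zero_mul, zero_mul]
  · refine mul_le_mul_of_nonneg_left ?_ (div_nonneg ArithmeticFunction.vonMangoldt_nonneg (Real.sqrt_nonneg _))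
    rw [hstar n hn hΛ]
    linarith [neg_norm_le_re_mul_of_norm_le_one (hv n) (weilConv u (weilReflect u) (Real.log n))]

/-- Mirror statement: if `v₊` is ALIGNED with the spikes of `u`, the key `(a, L, v₊)` has the SMALLEST form on `u`
among all data of norm `≤ 1`. [folklore] -/
theorem keyMarkovForm_ge_of_aligned_of_isWindowFunction (hu : IsWindowFunction b u) (a : ℕ) (L : ℝ)
    {v vplus : ℕ → ℂ} (hv : ∀ n, ‖v n‖ ≤ 1)
    (hplus : ∀ n ∈ weilPrimeIndex b, Λ n ≠ 0 →
      (vplus n * weilConv u (weilReflect u) (Real.log n)).re = ‖weilConv u (weilReflect u) (Real.log n)‖) :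
    keyMarkovForm a L vplus b u ≤ keyMarkovForm a L v b u := by
  rw [keyMarkovForm_eq_zero_key_sub_of_isWindowFunction hu a L v b,
    keyMarkovForm_eq_zero_key_sub_of_isWindowFunction hu a L vplus b]
  refine sub_le_sub_left (Finset.sum_le_sum fun n hn ↦ ?_) _
  by_cases hΛ : Λ n = 0
  · rw [hΛ, zero_div, zero_mul, zero_mul]
  · refine mul_le_mul_of_nonneg_left ?_ (div_nonneg ArithmeticFunction.vonMangoldt_nonneg (Real.sqrt_nonneg _))
    rw [hplus n hn hΛ]
    linarith [re_mul_le_norm_of_norm_le_one (hv n) (weilConv u (weilReflect u) (Real.log n))]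

/-! ## Real window functions: the sign condition and the character torus -/

/-- **The affine law for a REAL window function**:
`keyMarkovForm a L v b u = keyMarkovForm a L 0 b u − Σ_{log n<2b} a_n(u)·Re v(n)`, `a_n(u) = (Λ(n)/√n)·2(u ⋆ ũ)(log n)`.
[cite: Weil1952FormulesExplicites, (11) pp. 261–262] -/
theorem keyMarkovForm_eq_of_real_of_isWindowFunction (hu : IsWindowFunction b u)
    (hreal : ∀ t, conj (u t) = u t) (a : ℕ) (L : ℝ) (v : ℕ → ℂ) :
    keyMarkovForm a L v b u = keyMarkovForm a L 0 b u -
      ∑ n ∈ weilPrimeIndex b,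
        (Λ n : ℝ) / Real.sqrt n * (2 * (weilConv u (weilReflect u) (Real.log n)).re) * (v n).re := by
  rw [keyMarkovForm_eq_zero_key_sub_of_isWindowFunction hu a L v b]
  congr 1
  refine Finset.sum_congr rfl fun n _ ↦ ?_
  rw [re_mul_weilConv_weilReflect_of_real hreal]
  ring

/-- The same with the spike sum over `n ≤ N` (`e^{2b} ≤ N + 1`). [folklore] -/
theorem keyMarkovForm_eq_of_real_range_of_isWindowFunction (hu : IsWindowFunction b u)
    (hreal : ∀ t, conj (u t) = u t) {N : ℕ} (hN : Real.exp (2 * b) ≤ (N : ℝ) + 1) (a : ℕ) (L : ℝ)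
    (v : ℕ → ℂ) :
    keyMarkovForm a L v b u = keyMarkovForm a L 0 b u -
      ∑ n ∈ Finset.range (N + 1),
        (Λ n : ℝ) / Real.sqrt n * (2 * (weilConv u (weilReflect u) (Real.log n)).re) * (v n).re := by
  rw [keyMarkovForm_eq_zero_key_sub_of_isWindowFunction hu a L v b,
    ← sum_range_spikes_eq_sum_weilPrimeIndex_of_isWindowFunction hu hN v]
  congr 1
  refine Finset.sum_congr rfl fun n _ ↦ ?_
  rw [re_mul_weilConv_weilReflect_of_real hreal]
  ring

/-- **Maximum principle for a real window function = a sign condition**: `Re v⋆(n)·(u ⋆ ũ)(log n) = −|(u ⋆ ũ)(log n)|`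
at the visible `n` with `Λ(n) ≠ 0` gives `keyMarkovForm a L v b u ≤ keyMarkovForm a L v⋆ b u` for all data of norm
`≤ 1`. [folklore] -/
theorem keyMarkovForm_le_of_real_sign_of_isWindowFunction (hu : IsWindowFunction b u)
    (hreal : ∀ t, conj (u t) = u t) (a : ℕ) (L : ℝ) {v vstar : ℕ → ℂ} (hv : ∀ n, ‖v n‖ ≤ 1)
    (hstar : ∀ n ∈ weilPrimeIndex b, Λ n ≠ 0 →
      (vstar n).re * (weilConv u (weilReflect u) (Real.log n)).re =
        -|(weilConv u (weilReflect u) (Real.log n)).re|) :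
    keyMarkovForm a L v b u ≤ keyMarkovForm a L vstar b u :=
  keyMarkovForm_le_of_antialigned_of_isWindowFunction hu a L hv fun n hn hΛ ↦ by
    rw [re_mul_weilConv_weilReflect_of_real hreal, norm_weilConv_weilReflect_of_real hreal]
    exact hstar n hn hΛ

/-- The spike sum on `N ≤ 4` visible integers, written out (`Λ(0) = Λ(1) = 0`). [folklore] -/
theorem spikeSum_range_five (v : ℕ → ℂ) (c : ℕ → ℝ) :
    ∑ n ∈ Finset.range (4 + 1), (Λ n : ℝ) / Real.sqrt n * c n * (v n).re =
      (Λ 2 : ℝ) / Real.sqrt 2 * c 2 * (v 2).re + (Λ 3 : ℝ) / Real.sqrt 3 * c 3 * (v 3).re +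
        (Λ 4 : ℝ) / Real.sqrt 4 * c 4 * (v 4).re := by
  simp [Finset.sum_range_succ, ArithmeticFunction.vonMangoldt_apply_one]

/-- The same with `N = 3`. [folklore] -/
theorem spikeSum_range_four (v : ℕ → ℂ) (c : ℕ → ℝ) :
    ∑ n ∈ Finset.range (3 + 1), (Λ n : ℝ) / Real.sqrt n * c n * (v n).re =
      (Λ 2 : ℝ) / Real.sqrt 2 * c 2 * (v 2).re + (Λ 3 : ℝ) / Real.sqrt 3 * c 3 * (v 3).re := by
  simp [Finset.sum_range_succ, ArithmeticFunction.vonMangoldt_apply_one]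

/-- The same with `N = 2`. [folklore] -/
theorem spikeSum_range_three (v : ℕ → ℂ) (c : ℕ → ℝ) :
    ∑ n ∈ Finset.range (2 + 1), (Λ n : ℝ) / Real.sqrt n * c n * (v n).re =
      (Λ 2 : ℝ) / Real.sqrt 2 * c 2 * (v 2).re := by
  simp [Finset.sum_range_succ, ArithmeticFunction.vonMangoldt_apply_one]

/-- **THE `(5/·)` PHASES ARE THE WORST CASE ON A WINDOW FUNCTION WITH `e^{2b} ≤ 5`.**  `u` a real window function
on `[-b, b]` with spikes `a_n = (Λ(n)/√n)·2(u ⋆ ũ)(log n)` satisfying `a₂ ≥ 4a₄ ≥ 0`, `a₃ ≥ 0`; then for every torus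
datum (`‖v(2)‖, ‖v(3)‖ ≤ 1`, `v(4) = v(2)²`) and `v⋆(2) = v⋆(3) = −1`, `v⋆(4) = 1`:
`keyMarkovForm a L v b u ≤ keyMarkovForm a L v⋆ b u`. [folklore] -/
theorem keyMarkovForm_le_of_real_torus_four_of_isWindowFunction (hu : IsWindowFunction b u)
    (hreal : ∀ t, conj (u t) = u t) (hb : Real.exp (2 * b) ≤ 5) (a : ℕ) (L : ℝ) {v vstar : ℕ → ℂ}
    (hv2 : ‖v 2‖ ≤ 1) (hv3 : ‖v 3‖ ≤ 1) (hv4 : v 4 = v 2 ^ 2)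
    (hs2 : vstar 2 = -1) (hs3 : vstar 3 = -1) (hs4 : vstar 4 = 1)
    (h3 : 0 ≤ (Λ 3 : ℝ) / Real.sqrt 3 * (2 * (weilConv u (weilReflect u) (Real.log 3)).re))
    (h4 : 0 ≤ (Λ 4 : ℝ) / Real.sqrt 4 * (2 * (weilConv u (weilReflect u) (Real.log 4)).re))
    (h24 : 4 * ((Λ 4 : ℝ) / Real.sqrt 4 * (2 * (weilConv u (weilReflect u) (Real.log 4)).re)) ≤
      (Λ 2 : ℝ) / Real.sqrt 2 * (2 * (weilConv u (weilReflect u) (Real.log 2)).re)) :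
    keyMarkovForm a L v b u ≤ keyMarkovForm a L vstar b u := by
  have hN : Real.exp (2 * b) ≤ ((4 : ℕ) : ℝ) + 1 := by rw [show ((4 : ℕ) : ℝ) + 1 = 5 by norm_num]; exact hb
  rw [keyMarkovForm_eq_of_real_range_of_isWindowFunction hu hreal hN a L v,
    keyMarkovForm_eq_of_real_range_of_isWindowFunction hu hreal hN a L vstar]
  refine sub_le_sub_left ?_ _
  rw [spikeSum_range_five v (fun n ↦ 2 * (weilConv u (weilReflect u) (Real.log n)).re),
    spikeSum_range_five vstar (fun n ↦ 2 * (weilConv u (weilReflect u) (Real.log n)).re)]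
  simp only [hs2, hs3, hs4, hv4, Complex.neg_re, Complex.one_re, Nat.cast_ofNat]
  have hc := torus_coupling_le hv2 h4 h24
  have h3' := neg_le_mul_re_of_norm_le_one hv3 h3
  linarith

/-- `e^{2b} ≤ 4` (`b ≤ log 2`): visible `2, 3`, unconstrained; `a₂, a₃ ≥ 0` suffice. [folklore] -/
theorem keyMarkovForm_le_of_real_three_of_isWindowFunction (hu : IsWindowFunction b u)
    (hreal : ∀ t, conj (u t) = u t) (hb : Real.exp (2 * b) ≤ 4) (a : ℕ) (L : ℝ) {v vstar : ℕ → ℂ}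
    (hv2 : ‖v 2‖ ≤ 1) (hv3 : ‖v 3‖ ≤ 1) (hs2 : vstar 2 = -1) (hs3 : vstar 3 = -1)
    (h2 : 0 ≤ (Λ 2 : ℝ) / Real.sqrt 2 * (2 * (weilConv u (weilReflect u) (Real.log 2)).re))
    (h3 : 0 ≤ (Λ 3 : ℝ) / Real.sqrt 3 * (2 * (weilConv u (weilReflect u) (Real.log 3)).re)) :
    keyMarkovForm a L v b u ≤ keyMarkovForm a L vstar b u := by
  have hN : Real.exp (2 * b) ≤ ((3 : ℕ) : ℝ) + 1 := by rw [show ((3 : ℕ) : ℝ) + 1 = 4 by norm_num]; exact hb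
  rw [keyMarkovForm_eq_of_real_range_of_isWindowFunction hu hreal hN a L v,
    keyMarkovForm_eq_of_real_range_of_isWindowFunction hu hreal hN a L vstar]
  refine sub_le_sub_left ?_ _
  rw [spikeSum_range_four v (fun n ↦ 2 * (weilConv u (weilReflect u) (Real.log n)).re),
    spikeSum_range_four vstar (fun n ↦ 2 * (weilConv u (weilReflect u) (Real.log n)).re)]
  simp only [hs2, hs3, Complex.neg_re, Complex.one_re, Nat.cast_ofNat]
  have h2' := neg_le_mul_re_of_norm_le_one hv2 h2
  have h3' := neg_le_mul_re_of_norm_le_one hv3 h3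
  linarith

/-- `e^{2b} ≤ 3` (`b ≤ (log 3)/2`): visible `2` only; `a₂ ≥ 0` suffices. [folklore] -/
theorem keyMarkovForm_le_of_real_two_of_isWindowFunction (hu : IsWindowFunction b u)
    (hreal : ∀ t, conj (u t) = u t) (hb : Real.exp (2 * b) ≤ 3) (a : ℕ) (L : ℝ) {v vstar : ℕ → ℂ}
    (hv2 : ‖v 2‖ ≤ 1) (hs2 : vstar 2 = -1)
    (h2 : 0 ≤ (Λ 2 : ℝ) / Real.sqrt 2 * (2 * (weilConv u (weilReflect u) (Real.log 2)).re)) :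
    keyMarkovForm a L v b u ≤ keyMarkovForm a L vstar b u := by
  have hN : Real.exp (2 * b) ≤ ((2 : ℕ) : ℝ) + 1 := by rw [show ((2 : ℕ) : ℝ) + 1 = 3 by norm_num]; exact hb
  rw [keyMarkovForm_eq_of_real_range_of_isWindowFunction hu hreal hN a L v,
    keyMarkovForm_eq_of_real_range_of_isWindowFunction hu hreal hN a L vstar]
  refine sub_le_sub_left ?_ _
  rw [spikeSum_range_three v (fun n ↦ 2 * (weilConv u (weilReflect u) (Real.log n)).re),
    spikeSum_range_three vstar (fun n ↦ 2 * (weilConv u (weilReflect u) (Real.log n)).re)]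
  simp only [hs2, Complex.neg_re, Complex.one_re, Nat.cast_ofNat]
  have h2' := neg_le_mul_re_of_norm_le_one hv2 h2
  linarith

/-! ## Trigonometric sections: realness and the autocorrelation in closed form -/

/-- `conj χ_n = χ_{−n}` pointwise. [cite: Yoshida1992, §3 p. 289] -/
theorem conj_chi_apply (b : ℝ) (n : ℤ) (x : ℝ) : conj (chi b n x) = chi b (-n) x := by
  unfold chi
  by_cases hx : x ∈ Icc (-b) b
  · rw [indicator_of_mem hx, indicator_of_mem hx]
    unfold chiCore
    rw [map_mul, Complex.conj_ofReal, ← Complex.exp_conj]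
    congr 2
    simp only [map_div₀, map_mul, Complex.conj_ofReal, Complex.conj_I, map_intCast, Int.cast_neg]
    ring
  · rw [indicator_of_notMem hx, indicator_of_notMem hx, map_zero]

/-- **A section with `c_{−n} = conj c_n` is real** (`u = Σ_{|n|≤N} c_nχ_n`; real EVEN vectors `c_{−n} = c_n ∈ ℝ` = the
cosine block; for the sine block with real odd `x` use `c_n = i x_n`, the same function up to the phase `i`). [folklore] -/
theorem conj_sum_modes_smul_chi (b : ℝ) (N : ℕ) {c : ℤ → ℂ} (hc : ∀ n, c (-n) = conj (c n)) (x : ℝ) :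
    conj ((∑ n ∈ modes N, c n • chi b n) x) = (∑ n ∈ modes N, c n • chi b n) x := by
  rw [sum_smul_chi_apply, map_sum]
  simp_rw [map_mul, conj_chi_apply]
  refine Finset.sum_equiv (Equiv.neg ℤ) (fun n ↦ ?_) (fun n _ ↦ ?_)
  · simp only [Equiv.neg_apply, mem_modes, abs_neg]
  · simp only [Equiv.neg_apply]
    rw [hc n]

/-- **The autocorrelation of a trigonometric section in closed form**: for `u = Σ_{n∈s} c_nχ_n`, `b > 0` and a lag
`0 ≤ t ≤ 2b`, `(u ⋆ ũ)(t) = Σ_m Σ_n c_m conj(c_n) · shiftCoeff b t m n` — so the spikes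
`α_k(c) = (Λ(k)/√k)·2 Re (u ⋆ ũ)(log k)` of a certified coefficient vector are finite closed-form expressions
(the three sign checks of the single-state certificate). [cite: Yoshida1992, §5 (5.13)–(5.16)] -/
theorem weilConv_weilReflect_sum_smul_chi (hb : 0 < b) (s : Finset ℤ) (c : ℤ → ℂ) {t : ℝ} (ht0 : 0 ≤ t)
    (ht : t ≤ 2 * b) :
    weilConv (∑ n ∈ s, c n • chi b n) (weilReflect (∑ n ∈ s, c n • chi b n)) t =
      ∑ m ∈ s, ∑ n ∈ s, c m * conj (c n) * shiftCoeff b t m n := by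
  rw [weilConv_weilReflect_eq_integral_shift_pair]
  exact integral_shift_mul_conj_sum_smul_chi hb s c ht0 ht

/-! ## The section principle, eigenvalue-free -/

/-- **THE SECTION ONE-VECTOR PRINCIPLE (any finite window family).**  Let `f_i`, `i ∈ s`, be window functions on
`[-b, b]` (`b ≥ 0`), `x` ONE coefficient vector, `u = Σ x_i f_i`, and `v⋆` anti-aligned with the spikes of `u`.
If the Rayleigh quotient of `u` at the key `(a, L, v⋆)` is certified, `keyMarkovForm a L v⋆ b u ≤ B‖u‖₂²`, then for
EVERY datum `v` of norm `≤ 1` the hermitian section form satisfies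
`Re Σ_i Σ_j x_i conj(x_j) S_v(f_i, f_j) ≤ B‖u‖₂²` — the bottom of the section matrix `S(v)` is `≤ B` at every
datum, witnessed by the same vector (the `≤` half of «sup_z λ_min S_N(z) = λ_min S_N(z⋆)»). [folklore] -/
theorem section_re_sum_le_of_antialigned (hb : 0 ≤ b) {ι : Type*} (s : Finset ι) {f : ι → ℝ → ℂ}
    (hf : ∀ i ∈ s, IsWindowFunction b (f i)) (x : ι → ℂ) (a : ℕ) (L : ℝ) {v vstar : ℕ → ℂ}
    (hv : ∀ n, ‖v n‖ ≤ 1)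
    (hstar : ∀ n ∈ weilPrimeIndex b, Λ n ≠ 0 →
      (vstar n * weilConv (∑ i ∈ s, x i • f i) (weilReflect (∑ i ∈ s, x i • f i)) (Real.log n)).re =
        -‖weilConv (∑ i ∈ s, x i • f i) (weilReflect (∑ i ∈ s, x i • f i)) (Real.log n)‖)
    {B : ℝ} (hB : keyMarkovForm a L vstar b (∑ i ∈ s, x i • f i) ≤ B * ∫ y, ‖(∑ i ∈ s, x i • f i) y‖ ^ 2) :
    (∑ i ∈ s, ∑ j ∈ s, x i * conj (x j) * keyWindowSesq a L v b (f i) (f j)).re ≤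
      B * ∫ y, ‖(∑ i ∈ s, x i • f i) y‖ ^ 2 := by
  rw [← keyMarkovForm_sum_smul_eq_re hb s hf x a L v]
  exact (keyMarkovForm_le_of_antialigned_of_isWindowFunction (IsWindowFunction.sum s x hf) a L hv hstar).trans hB

/-- **The section principle on Yoshida's windows** (`b > 0`, orthonormal basis: `‖Σ x_nχ_n‖₂² = Σ |x_n|²`): with
`G_v(m, n) = keyWindowSesq a L v b χ_m χ_n`, ONE vector `x` anti-aligned to `v⋆` and `keyMarkovForm a L v⋆ b u ≤ B Σ|x_n|²`
give `Re x*G_v x ≤ B Σ|x_n|²` for every datum `v` of norm `≤ 1`. [folklore] -/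
theorem section_re_sum_le_of_antialigned_chi (hb : 0 < b) (s : Finset ℤ) (x : ℤ → ℂ) (a : ℕ) (L : ℝ)
    {v vstar : ℕ → ℂ} (hv : ∀ n, ‖v n‖ ≤ 1)
    (hstar : ∀ n ∈ weilPrimeIndex b, Λ n ≠ 0 →
      (vstar n * weilConv (∑ m ∈ s, x m • chi b m) (weilReflect (∑ m ∈ s, x m • chi b m)) (Real.log n)).re =
        -‖weilConv (∑ m ∈ s, x m • chi b m) (weilReflect (∑ m ∈ s, x m • chi b m)) (Real.log n)‖)
    {B : ℝ} (hB : keyMarkovForm a L vstar b (∑ m ∈ s, x m • chi b m) ≤ B * ∑ n ∈ s, ‖x n‖ ^ 2) :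
    (∑ m ∈ s, ∑ n ∈ s, x m * conj (x n) * keyWindowSesq a L v b (chi b m) (chi b n)).re ≤
      B * ∑ n ∈ s, ‖x n‖ ^ 2 := by
  rw [← integral_norm_sq_sum_smul_chi hb s x] at hB ⊢
  exact section_re_sum_le_of_antialigned hb.le s (fun n _ ↦ isWindowFunction_chi hb n) x a L hv hstar hB

/-- **The section principle for a REAL section = three sign checks** (the shape of weil-grh-4's single-state
certificates G33, GRH/STRUCTURE §16(f)–§17): `b > 0`, `e^{2b} ≤ 5`; `x` on `modes N` with `x_{−n} = conj x_n` (so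
`u = Σ x_nχ_n` is real); torus data (`‖v(2)‖, ‖v(3)‖ ≤ 1`, `v(4) = v(2)²`) against the `(5/·)` phases `v⋆`; sign
checks `a₃(u) ≥ 0`, `a₄(u) ≥ 0`, `4a₄(u) ≤ a₂(u)` on the closed-form spikes; certified Rayleigh bound
`keyMarkovForm a L v⋆ b u ≤ B Σ|x_n|²`.  Then `Re x*G_v x ≤ B Σ|x_n|²` for EVERY torus datum `v`. [folklore] -/
theorem section_re_sum_le_of_real_torus_four_chi (hb : 0 < b) (hb5 : Real.exp (2 * b) ≤ 5) (N : ℕ)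
    {x : ℤ → ℂ} (hx : ∀ n, x (-n) = conj (x n)) (a : ℕ) (L : ℝ) {v vstar : ℕ → ℂ}
    (hv2 : ‖v 2‖ ≤ 1) (hv3 : ‖v 3‖ ≤ 1) (hv4 : v 4 = v 2 ^ 2)
    (hs2 : vstar 2 = -1) (hs3 : vstar 3 = -1) (hs4 : vstar 4 = 1)
    (h3 : 0 ≤ (Λ 3 : ℝ) / Real.sqrt 3 * (2 * (weilConv (∑ m ∈ modes N, x m • chi b m)
      (weilReflect (∑ m ∈ modes N, x m • chi b m)) (Real.log 3)).re))
    (h4 : 0 ≤ (Λ 4 : ℝ) / Real.sqrt 4 * (2 * (weilConv (∑ m ∈ modes N, x m • chi b m)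
      (weilReflect (∑ m ∈ modes N, x m • chi b m)) (Real.log 4)).re))
    (h24 : 4 * ((Λ 4 : ℝ) / Real.sqrt 4 * (2 * (weilConv (∑ m ∈ modes N, x m • chi b m)
        (weilReflect (∑ m ∈ modes N, x m • chi b m)) (Real.log 4)).re)) ≤
      (Λ 2 : ℝ) / Real.sqrt 2 * (2 * (weilConv (∑ m ∈ modes N, x m • chi b m)
        (weilReflect (∑ m ∈ modes N, x m • chi b m)) (Real.log 2)).re))
    {B : ℝ} (hB : keyMarkovForm a L vstar b (∑ m ∈ modes N, x m • chi b m) ≤ B * ∑ n ∈ modes N, ‖x n‖ ^ 2) :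
    (∑ m ∈ modes N, ∑ n ∈ modes N, x m * conj (x n) * keyWindowSesq a L v b (chi b m) (chi b n)).re ≤
      B * ∑ n ∈ modes N, ‖x n‖ ^ 2 := by
  have hreal : ∀ t, conj ((∑ m ∈ modes N, x m • chi b m) t) = (∑ m ∈ modes N, x m • chi b m) t :=
    conj_sum_modes_smul_chi b N hx
  rw [← integral_norm_sq_sum_smul_chi hb (modes N) x] at hB ⊢
  rw [← keyMarkovForm_sum_smul_chi hb (modes N) x a L v]
  exact (keyMarkovForm_le_of_real_torus_four_of_isWindowFunction
    (IsWindowFunction.sum (modes N) x fun n _ ↦ isWindowFunction_chi hb n) hreal hb5 a L hv2 hv3 hv4 hs2 hs3 hs4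
      h3 h4 h24).trans hB

end Summit.Ventures.WeilGRH

end
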